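import Summits.RiemannHypothesis.RiemannHypothesis.Theses.OddSector
import Literature.NumberTheory.LFunctions.WeilOddGroundState
import Literature.NumberTheory.LFunctions.WeilOddThetaVector
import Literature.NumberTheory.LFunctions.WeilThetaPhiMellin
import Literature.NumberTheory.LFunctions.WeilMarkovQuadratic
import Literature.NumberTheory.LFunctions.DeBruijnPhiDecreasing
import Literature.NumberTheory.LFunctions.DeBruijnPhiSecondDeriv
import Literature.NumberTheory.LFunctions.WeilGroundStateRealZerosProofs
import Summits.RiemannHypothesis.RiemannHypothesis.Theorems.WeilGroundStateGroundStatesConvergeToXiEulerLagrange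

/-!
# Crux `OddSector.OddBartaFloor` (stmt-RiemannHypothesis-17779) — line `Sketch`: the skeleton

THE ODD BARTA FLOOR: there are `e → 0` and `a₀` such that at every window `a ≥ a₀` carrying a
one-signed odd bottom state `u`, `ε_od(a) ≥ −e(a)`.

Mechanism (2001 programme, route `odd-sector-eigenfunction-sign`, results §§2–4, re-derived against the
tree): the odd theta vector `H_a = 𝟙_{[−a,a]}·(−Φ′)` (`weilOddThetaVector a`) is the window truncation of
the GLOBAL NULL VECTOR `−Φ′` of Weil's form (`(Φ′)^(s) = −(s−½)ξ(s)`), so for window tests `g` the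
polarised functional is the off-diagonal image of the odd tail: `W(g ⋆ H̃_a) = ∫ g T_a` (stubs
`thetaNull`, `tailWindow`, `tailLimit`; `asmTransport`), with `T_a = 2ϖ_a sinh(t/2) + primeLayer +
archLayer` and `T_a ≥ −e(a)H_a` on `(0,a)` for `a ≥ a₀`, `e → 0` (stubs `phiKit`, `imageRegularity`,
`primeLayerFloor`; `asmFloor`). The weak Euler–Lagrange identity of the odd bottom state AGAINST THE BV
PROBE, `W(gₙ ⋆ H̃_a) → ε_od(a) ∫ u H_a` along the minimising sequence, comes from the odd Cauchy–Schwarz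
polar bound, smooth odd cut-off approximants of `H_a` with uniformly bounded energy, and continuity of
`h ↦ W(g ⋆ h̃)` under dominated convergence (stubs `oddPolarDefect`, `thetaApproximants`, `energyBound`,
`polarContinuity`; `asmEulerLagrange`). Barta: `ε_od ∫ uH_a = ∫ uT_a ≥ −e ∫ uH_a` and `∫ uH_a > 0`.
-/

set_option linter.dupNamespace false

noncomputable section

open Set MeasureTheory Filter Complex
open scoped Real Topology ComplexConjugate ArithmeticFunction.vonMangoldt ENNReal

namespace Summit.RiemannHypothesis.RiemannHypothesis.Theorems.OddBartaFloor

open Literature.NumberTheory.LFunctions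
open Summit.RiemannHypothesis.RiemannHypothesis.Theses.OddSector

/-! ## Definitions (TEMPORARY inline copy of the landed `Theorems/OddSectorOddBartaFloorDefs.lean`, p145286 — replaced by the import once the farm has built that module) -/

/-- The ODD TAIL `R_a := −Φ′ − H_a`, i.e. `R_a(s) = −Φ′(s)` for `|s| > a` and `0` on the window
`[−a, a]` (so that `H_a = −Φ′ − R_a`, the window truncation of the null vector `−Φ′`). Odd; `≥ 0` on
`(a, ∞)` since `Φ′ < 0` there. -/
def oddThetaTail (a : ℝ) (s : ℝ) : ℝ :=
  -weilThetaPhiDeriv s - weilOddThetaVector a s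

/-- The TRUNCATED odd tail `R_{a,b} := H_b − H_a`, i.e. for `a ≤ b`: `R_{a,b}(s) = −Φ′(s)` for
`a < |s| ≤ b` and `0` elsewhere (a bounded, compactly supported, odd function). -/
def oddThetaTailTrunc (a b : ℝ) (s : ℝ) : ℝ :=
  weilOddThetaVector b s - weilOddThetaVector a s

/-- The POLAR WEIGHT of the tail, `ϖ_a := ∫_{s > a} (−Φ′(s)) · 2 sinh(s/2) ds` (`= −R̂_a(0) = R̂_a(1)`
for the Mellin–Laplace transform `R̂ = weilMellin` of the odd tail). -/
def oddThetaPolarWeight (a : ℝ) : ℝ :=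
  ∫ s in Ioi a, (-weilThetaPhiDeriv s) * (2 * Real.sinh (s / 2))

/-- The truncated polar weight `ϖ_{a,b} := ∫_{a < s ≤ b} (−Φ′(s)) · 2 sinh(s/2) ds`. -/
def oddThetaPolarWeightTrunc (a b : ℝ) : ℝ :=
  ∫ s in Ioc a b, (-weilThetaPhiDeriv s) * (2 * Real.sinh (s / 2))

/-- The PRIME LAYER of the window image: `Σ_n Λ(n) n^{-1/2} (R_a(t − log n) + R_a(t + log n))`
(for `t ∈ (0, a)`: the right-tail translates `R_a(t + log n) ≥ 0` minus the wrong-sign layer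
`−R_a(t − log n) = |Φ′(log n − t)| 𝟙_{log n > a + t}`). -/
def oddThetaPrimeLayer (a : ℝ) (t : ℝ) : ℝ :=
  ∑' n : ℕ, (Λ n : ℝ) / Real.sqrt n * (oddThetaTail a (t - Real.log n) + oddThetaTail a (t + Real.log n))

/-- The truncated prime layer (same with `R_{a,b}`; a finitely supported sum). -/
def oddThetaPrimeLayerTrunc (a b : ℝ) (t : ℝ) : ℝ :=
  ∑' n : ℕ, (Λ n : ℝ) / Real.sqrt n *
    (oddThetaTailTrunc a b (t - Real.log n) + oddThetaTailTrunc a b (t + Real.log n))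

/-- The ARCHIMEDEAN LAYER of the window image: `∫ R_a(s) w(|t − s|) ds`, `w = weilArchDensity`
(for `t ∈ (0,a)`: `= ∫_{s>a} (−Φ′(s)) (w(s − t) − w(s + t)) ds ≥ 0`; logarithmically singular as
`t → ±a`). A real Bochner integral. -/
def oddThetaArchLayer (a : ℝ) (t : ℝ) : ℝ :=
  ∫ s, oddThetaTail a s * weilArchDensity |t - s|

/-- The truncated archimedean layer (same with `R_{a,b}`). -/
def oddThetaArchLayerTrunc (a b : ℝ) (t : ℝ) : ℝ :=
  ∫ s, oddThetaTailTrunc a b s * weilArchDensity |t - s|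

/-- The WINDOW IMAGE `T_a(t) = 2ϖ_a sinh(t/2) + (prime layer) + (archimedean layer)` of the odd theta
vector: `W(g ⋆ H̃_a) = ∫ g T_a` for window tests `g` (2001 results §3, `A_aH_a` on `(−a, a)`). -/
def oddThetaImage (a : ℝ) (t : ℝ) : ℝ :=
  2 * oddThetaPolarWeight a * Real.sinh (t / 2) + oddThetaPrimeLayer a t + oddThetaArchLayer a t

/-- The truncated window image `T_{a,b}`: `W(g ⋆ (H_b − H_a)~) = −∫ g T_{a,b}` for window tests `g`
and `a ≤ b`, and `T_{a,b} → T_a` on the window as `b → ∞`. -/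
def oddThetaImageTrunc (a b : ℝ) (t : ℝ) : ℝ :=
  2 * oddThetaPolarWeightTrunc a b * Real.sinh (t / 2) + oddThetaPrimeLayerTrunc a b t +
    oddThetaArchLayerTrunc a b t

/-! ## Stubs (registered; each lands as its own `--supports` file) -/

/-- (V1) Odd-sector Cauchy–Schwarz for the polarised functional (odd twin of
`ConnesVanSuijlekom.abs_polar_le`). -/
theorem stub_oddPolarDefect :
    ∀ (a : ℝ) (f h : ℝ → ℂ), IsWeilTest f → tsupport f ⊆ Icc (-a) a → (∀ t, f (-t) = -f t) →
      IsWeilTest h → tsupport h ⊆ Icc (-a) a → (∀ t, h (-t) = -h t) →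
      |(weilFunctional (weilConv f (weilReflect h)) + weilFunctional (weilConv h (weilReflect f))).re
          - 2 * weilOddGroundEnergy a * (∫ t, f t * conj (h t)).re| ≤
        2 * Real.sqrt ((weilQuadratic f).re - weilOddGroundEnergy a * ∫ t, ‖f t‖ ^ 2) *
          Real.sqrt ((weilQuadratic h).re - weilOddGroundEnergy a * ∫ t, ‖h t‖ ^ 2) := by
  sorry

/-- (V2i) `Φ′ = weilThetaPhiDeriv` is smooth (all derivatives of the building blocks `E_{j,k}` are again
combinations of `E`'s, `hasDerivAt_expThetaMoment`). -/
theorem stub_phiDerivSmooth : ContDiff ℝ ((⊤ : ℕ∞) : WithTop ℕ∞) weilThetaPhiDeriv := by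
  sorry

/-- (V2ii) Smooth odd cut-off approximants of the BV probe `H_a` with uniformly Lipschitz increments
(given the smoothness of `Φ′`). -/
theorem stub_thetaApproximants :
    ContDiff ℝ ((⊤ : ℕ∞) : WithTop ℕ∞) weilThetaPhiDeriv →
    ∀ a : ℝ, 0 < a → ∃ K : ℝ, ∃ h : ℕ → ℝ → ℂ,
      (∀ m, IsWeilTest (h m) ∧ tsupport (h m) ⊆ Icc (-a) a ∧ (∀ t, h m (-t) = -h m t)) ∧
      (∀ m s, 0 ≤ s → weilIncrement (h m) s ≤ K * s) ∧
      (∀ m t, ‖h m t‖ ≤ |weilOddThetaVector a t|) ∧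
      (∀ t, t ∈ Ioo (-a) a → Tendsto (fun m => h m t) atTop (𝓝 ((weilOddThetaVector a t : ℝ) : ℂ))) := by
  sorry

/-- (V2b) Energy bound: window tests with a sup bound and Lipschitz increments have bounded `Re Q`. -/
theorem stub_energyBound :
    ∀ (a M L : ℝ), 0 < a → ∃ K : ℝ, ∀ h : ℝ → ℂ, IsWeilTest h → tsupport h ⊆ Icc (-a) a →
      (∀ t, ‖h t‖ ≤ M) → (∀ s, 0 ≤ s → weilIncrement h s ≤ L * s) → (weilQuadratic h).re ≤ K := by
  sorry

/-- (V3) Continuity of `h ↦ W(g ⋆ h̃)` under dominated a.e. convergence on a fixed window. -/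
theorem stub_polarContinuity :
    ∀ (a B : ℝ) (g : ℝ → ℂ) (F : ℝ → ℂ) (h : ℕ → ℝ → ℂ),
      IsWeilTest g → Measurable F → (∀ t, ‖F t‖ ≤ B) → (∀ t, t ∉ Icc (-a) a → F t = 0) →
      (∀ m, IsWeilTest (h m) ∧ tsupport (h m) ⊆ Icc (-a) a) → (∀ m t, ‖h m t‖ ≤ B) →
      (∀ᵐ t : ℝ, Tendsto (fun m => h m t) atTop (𝓝 (F t))) →
      Tendsto (fun m => weilFunctional (weilConv g (weilReflect (h m)))) atTop
        (𝓝 (weilFunctional (weilConv g (weilReflect F)))) := by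
  sorry

/-- (T1) The null identity: `W(g ⋆ H̃_b) → 0` as `b → ∞` (`Φ′` is a null vector of Weil's form). -/
theorem stub_thetaNull :
    ∀ g : ℝ → ℂ, IsWeilTest g →
      Tendsto (fun b : ℝ => weilFunctional (weilConv g (weilReflect fun t => ((weilOddThetaVector b t : ℝ) : ℂ))))
        atTop (𝓝 0) := by
  sorry

/-- (T2P) Window computation, polar term: `(g ⋆ R̃_{a,b})^(0) + (g ⋆ R̃_{a,b})^(1) = −2ϖ_{a,b} ∫ g sinh(t/2)`. -/
theorem stub_tailPolar :
    ∀ (a b : ℝ) (g : ℝ → ℂ), 0 < a → a ≤ b → IsWeilTest g → tsupport g ⊆ Icc (-a) a →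
      weilPolarTerm (weilConv g (weilReflect fun t => ((oddThetaTailTrunc a b t : ℝ) : ℂ))) =
        -(2 * (oddThetaPolarWeightTrunc a b : ℂ) * ∫ t, g t * (Real.sinh (t / 2) : ℂ)) := by
  sorry

/-- (T2Λ) Window computation, prime term: `Σ Λ n^{-1/2}(k(log n) + k(−log n)) = ∫ g P_{a,b}` for
`k = g ⋆ R̃_{a,b}` (a finite sum; Fubini). -/
theorem stub_tailPrime :
    ∀ (a b : ℝ) (g : ℝ → ℂ), 0 < a → a ≤ b → IsWeilTest g → tsupport g ⊆ Icc (-a) a →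
      Integrable (fun t => g t * ((oddThetaPrimeLayerTrunc a b t : ℝ) : ℂ)) ∧
      weilPrimeTerm (weilConv g (weilReflect fun t => ((oddThetaTailTrunc a b t : ℝ) : ℂ))) =
        ∫ t, g t * ((oddThetaPrimeLayerTrunc a b t : ℝ) : ℂ) := by
  sorry

/-- (T2A-i) Window computation, archimedean term, step 1 (Bombieri's form with `k(0) = 0`):
`W_∞(k) = −∫₀^∞ w(r)(k(r) + k(−r)) dr` for `k = g ⋆ R̃_{a,b}`. -/
theorem stub_tailArchBombieri :
    ∀ (a b : ℝ) (g : ℝ → ℂ), 0 < a → a ≤ b → IsWeilTest g → tsupport g ⊆ Icc (-a) a →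
      weilArchTerm (weilConv g (weilReflect fun t => ((oddThetaTailTrunc a b t : ℝ) : ℂ))) =
        -∫ r in Ioi (0 : ℝ), (weilArchDensity r : ℂ) *
          (weilConv g (weilReflect fun t => ((oddThetaTailTrunc a b t : ℝ) : ℂ)) r +
            weilConv g (weilReflect fun t => ((oddThetaTailTrunc a b t : ℝ) : ℂ)) (-r)) := by
  sorry

/-- (T2A-ii) Window computation, archimedean term, step 2 (Tonelli on the off-diagonal kernel):
`∫₀^∞ w(r)(k(r) + k(−r)) dr = ∫ g A_{a,b}`, with `g·A_{a,b}` integrable. -/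
theorem stub_tailArchFubini :
    ∀ (a b : ℝ) (g : ℝ → ℂ), 0 < a → a ≤ b → IsWeilTest g → tsupport g ⊆ Icc (-a) a →
      Integrable (fun t => g t * ((oddThetaArchLayerTrunc a b t : ℝ) : ℂ)) ∧
      ∫ r in Ioi (0 : ℝ), (weilArchDensity r : ℂ) *
          (weilConv g (weilReflect fun t => ((oddThetaTailTrunc a b t : ℝ) : ℂ)) r +
            weilConv g (weilReflect fun t => ((oddThetaTailTrunc a b t : ℝ) : ℂ)) (-r)) =
        ∫ t, g t * ((oddThetaArchLayerTrunc a b t : ℝ) : ℂ) := by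
  sorry

/-- (T3) The truncated window images converge to `T_a` UNIFORMLY on the open window. -/
theorem stub_tailUniform :
    ∀ a : ℝ, 0 < a → ∀ ε : ℝ, 0 < ε → ∃ b₀ : ℝ, ∀ b : ℝ, b₀ ≤ b → ∀ t ∈ Ioo (-a) a,
      |oddThetaImageTrunc a b t - oddThetaImage a t| ≤ ε := by
  sorry

/-- (F1-i) Termwise ratio bound for `|Φ′|` from the one-series form `deBruijnPhiDeriv_eq_tsum`:
`|Φ′(s₂)| ≤ 2e^{−(2πe^{2s₁} − 13/2)(s₂ − s₁)}|Φ′(s₁)|` for `s₂ ≥ s₁ ≥ 1/2`. -/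
theorem stub_phiRatio :
    ∀ s₁ s₂ : ℝ, 1 / 2 ≤ s₁ → s₁ ≤ s₂ →
      |weilThetaPhiDeriv s₂| ≤
        2 * rexp (-(2 * π * rexp (2 * s₁) - 13 / 2) * (s₂ - s₁)) * |weilThetaPhiDeriv s₁| := by
  sorry

/-- (F1-ii) Super-exponential (here: `e^{−4u}`) decay of `Φ_RT″` and the linear lower bound for `−Φ′`
on `[0, 1]`. -/
theorem stub_phiOrigin :
    (∃ C : ℝ, ∀ u : ℝ, 0 ≤ u → |deBruijnPhiDeriv₂ u| ≤ C * rexp (-4 * u)) ∧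
    (∃ c : ℝ, 0 < c ∧ ∀ t ∈ Icc (0 : ℝ) 1, c * t ≤ -weilThetaPhiDeriv t) := by
  sorry

/-- (F2-i) Sign of the window image pieces: polar weight and archimedean layer are non-negative
(`−Φ′ > 0` on `(0,∞)`, `w` antitone). -/
theorem stub_imagePositivity :
    ∀ a : ℝ, 0 < a → 0 ≤ oddThetaPolarWeight a ∧ (∀ t ∈ Ioo 0 a, 0 ≤ oddThetaArchLayer a t) := by
  sorry

/-- (F2-ii) The window image is square-integrable on the open window (bounded prime layer,
logarithmic edge singularity of the archimedean layer). -/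
theorem stub_imageMemLp :
    ∀ a : ℝ, 0 < a → MemLp (fun t => (Ioo (-a) a).indicator (oddThetaImage a) t) 2 volume := by
  sorry

/-- (F3) The prime-layer floor (the hardest stub): for large windows the wrong-sign prime layer is
dominated by `e(a)|Φ′|` with `e → 0`, on all of `(0,a)`. -/
theorem stub_primeLayerFloor :
    (∀ s₁ s₂ : ℝ, 1 / 2 ≤ s₁ → s₁ ≤ s₂ →
        |weilThetaPhiDeriv s₂| ≤
          2 * rexp (-(2 * π * rexp (2 * s₁) - 13 / 2) * (s₂ - s₁)) * |weilThetaPhiDeriv s₁|) →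
    (∃ C : ℝ, ∀ u : ℝ, 0 ≤ u → |deBruijnPhiDeriv₂ u| ≤ C * rexp (-4 * u)) →
    (∃ c : ℝ, 0 < c ∧ ∀ t ∈ Icc (0 : ℝ) 1, c * t ≤ -weilThetaPhiDeriv t) →
    ∃ a₀ : ℝ, ∃ e : ℝ → ℝ, Tendsto e atTop (𝓝 0) ∧ ∀ a : ℝ, a₀ ≤ a → ∀ t ∈ Ioo 0 a,
      e a * weilThetaPhiDeriv t ≤ oddThetaPrimeLayer a t := by
  sorry

/-! ## Assembly lemmas (held by the lead; proved from the stubs above as they land) -/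

/-- (A1) Weak Euler–Lagrange identity of an odd bottom state against the BV probe `H_a`. -/
theorem stub_asmEulerLagrange :
    ∀ (a : ℝ) (u : ℝ → ℂ) (g : ℕ → ℝ → ℂ), 0 < a →
      (∀ n, IsWeilTest (g n) ∧ tsupport (g n) ⊆ Icc (-a) a ∧ (∀ t, g n (-t) = -g n t) ∧
        ∫ t, ‖g n t‖ ^ 2 = (1 : ℝ)) →
      Tendsto (fun n => (weilQuadratic (g n)).re) atTop (𝓝 (weilOddGroundEnergy a)) →
      MemLp u 2 volume → Tendsto (fun n => ∫ t, ‖g n t - u t‖ ^ 2) atTop (𝓝 0) →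
      Tendsto (fun n => weilFunctional (weilConv (g n)
          (weilReflect fun t => ((weilOddThetaVector a t : ℝ) : ℂ)))) atTop
        (𝓝 ((weilOddGroundEnergy a : ℂ) * ∫ t, u t * ((weilOddThetaVector a t : ℝ) : ℂ))) := by
  sorry

/-- (A2) The transport identity `W(g ⋆ H̃_a) = ∫ g T_a` for window tests. -/
theorem stub_asmTransport :
    ∀ (a : ℝ) (g : ℝ → ℂ), 0 < a → IsWeilTest g → tsupport g ⊆ Icc (-a) a →
      weilFunctional (weilConv g (weilReflect fun t => ((weilOddThetaVector a t : ℝ) : ℂ))) =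
        ∫ t, g t * ((oddThetaImage a t : ℝ) : ℂ) := by
  sorry

/-- (A3) The pointwise supersolution inequality `T_a ≥ −e(a) H_a` on `(0,a)`, `e → 0`. -/
theorem stub_asmFloor :
    ∃ a₀ : ℝ, ∃ e : ℝ → ℝ, Tendsto e atTop (𝓝 0) ∧ ∀ a : ℝ, a₀ ≤ a → ∀ t ∈ Ioo 0 a,
      -(e a) * weilOddThetaVector a t ≤ oddThetaImage a t := by
  sorry


/-! ## Oddness of the window image -/

/-- The odd tail is odd: `R_a(−s) = −R_a(s)`. -/
theorem oddThetaTail_neg (a s : ℝ) : oddThetaTail a (-s) = -oddThetaTail a s := by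
  simp only [oddThetaTail, weilThetaPhiDeriv_neg, weilOddThetaVector_neg]
  ring

/-- The prime layer is odd. -/
theorem oddThetaPrimeLayer_neg (a t : ℝ) : oddThetaPrimeLayer a (-t) = -oddThetaPrimeLayer a t := by
  simp only [oddThetaPrimeLayer, ← tsum_neg]
  refine tsum_congr fun n => ?_
  have h1 : -t - Real.log n = -(t + Real.log n) := by ring
  have h2 : -t + Real.log n = -(t - Real.log n) := by ring
  rw [h1, h2, oddThetaTail_neg, oddThetaTail_neg]
  ring

/-- The archimedean layer is odd. -/
theorem oddThetaArchLayer_neg (a t : ℝ) : oddThetaArchLayer a (-t) = -oddThetaArchLayer a t := by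
  simp only [oddThetaArchLayer]
  rw [← integral_neg, ← integral_neg_eq_self (fun s : ℝ => oddThetaTail a s * weilArchDensity |(-t) - s|)]
  refine integral_congr_ae (Eventually.of_forall fun s => ?_)
  simp only [oddThetaTail_neg]
  rw [show |(-t) - (-s)| = |t - s| by rw [← abs_neg]; congr 1; ring]
  ring

/-- **The window image is odd**: `T_a(−t) = −T_a(t)`. -/
theorem oddThetaImage_neg (a t : ℝ) : oddThetaImage a (-t) = -oddThetaImage a t := by
  simp only [oddThetaImage, oddThetaPrimeLayer_neg, oddThetaArchLayer_neg, neg_div, Real.sinh_neg]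
  ring

/-! ## Barta's argument at a good window -/

/-- Reflection of an a.e. statement on `ℝ`: if `P` holds a.e. then `t ↦ P(−t)` holds a.e. -/
theorem ae_comp_neg {P : ℝ → Prop} (h : ∀ᵐ t : ℝ, P t) : ∀ᵐ t : ℝ, P (-t) :=
  (Measure.measurePreserving_neg (volume : Measure ℝ)).quasiMeasurePreserving.ae h

/-- **Barta's inequality at a good window.** If `T_a ≥ −e H_a` on `(0, a)`, `T_a` is square
integrable on the open window, the weak Euler–Lagrange identity against `H_a` and the transport identity
hold, and the window carries an odd bottom state `u` with `Im u = 0`, `Re u ≥ 0` a.e. on `(0,a)`, then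
`ε_od(a) ≥ −e`: indeed `ε_od ∫ uH_a = ∫ uT_a`, the integrand `Re u · (T_a + eH_a)` is `≥ 0` a.e. (on
`(−a, 0)` both factors change sign by oddness), and `∫ Re u · H_a > 0` because `u ≠ 0`. -/
theorem neg_le_weilOddGroundEnergy_of_floor {a e : ℝ} (ha : 0 < a)
    (hfl : ∀ t ∈ Ioo 0 a, -e * weilOddThetaVector a t ≤ oddThetaImage a t)
    {u : ℝ → ℂ} (hu : IsWeilOddGroundState a u)
    (hsign : ∀ᵐ t : ℝ, t ∈ Ioo 0 a → (u t).im = 0 ∧ 0 ≤ (u t).re) :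
    -e ≤ weilOddGroundEnergy a := by
  obtain ⟨hu2, g, hg, hQ, hL⟩ := (isWeilOddGroundState_iff_tendsto a u).1 hu
  set ε : ℝ := weilOddGroundEnergy a with hε
  set H : ℝ → ℝ := weilOddThetaVector a with hH
  set Hc : ℝ → ℂ := fun t => ((H t : ℝ) : ℂ) with hHc
  set T : ℝ → ℝ := (Ioo (-a) a).indicator (oddThetaImage a) with hT
  set Tc : ℝ → ℂ := fun t => ((T t : ℝ) : ℂ) with hTc
  -- (1) Euler–Lagrange limit and transport identity
  have hEL := stub_asmEulerLagrange a u g ha hg hQ hu2 hL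
  have hTr : ∀ n, weilFunctional (weilConv (g n) (weilReflect Hc)) = ∫ t, g n t * Tc t := by
    intro n
    rw [hHc, hH, stub_asmTransport a (g n) ha (hg n).1 (hg n).2.1]
    refine integral_congr_ae ?_
    have hnull : (volume : Measure ℝ) {-a, a} = 0 :=
      (Set.toFinite _).measure_zero volume
    filter_upwards [measure_eq_zero_iff_ae_notMem.1 hnull] with t ht
    simp only [mem_insert_iff, mem_singleton_iff, not_or] at ht
    by_cases htm : t ∈ Ioo (-a) a
    · simp [hTc, hT, indicator_of_mem htm]
    · have hnot : t ∉ tsupport (g n) := fun h' => by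
        have h2 := (hg n).2.1 h'
        simp only [mem_Icc] at h2
        simp only [mem_Ioo, not_and_or, not_lt] at htm
        rcases htm with h3 | h3
        · exact ht.1 (le_antisymm h3 h2.1 ▸ rfl)
        · exact ht.2 (le_antisymm h2.2 h3)
      simp [image_eq_zero_of_notMem_tsupport hnot]
  -- (2) the pairing with the square-integrable image passes to the limit
  have hTmem : MemLp T 2 volume := stub_imageMemLp a ha
  have hTcmem : MemLp Tc 2 volume := hTmem.ofReal
  have hpair : Tendsto (fun n => ∫ t, g n t * Tc t) atTop (𝓝 (∫ t, u t * Tc t)) := by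
    have h1 := ConnesVanSuijlekom.tendsto_integral_mul_conj_left (u := Tc) hTcmem hu2
      (fun n => ConnesVanSuijlekom.isWeilTest_memLp (hg n).1) hL
    have hconj : ∀ t, conj (Tc t) = Tc t := fun t => by simp [hTc, Complex.conj_ofReal]
    simp only [hconj] at h1
    exact h1
  have hlimC : (ε : ℂ) * ∫ t, u t * Hc t = ∫ t, u t * Tc t := by
    have h2 : Tendsto (fun n => ∫ t, g n t * Tc t) atTop (𝓝 ((ε : ℂ) * ∫ t, u t * Hc t)) :=
      hEL.congr hTr
    exact tendsto_nhds_unique h2 hpair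
  -- (3) real parts: `ε ∫ Re u · H = ∫ Re u · T`
  set v : ℝ → ℝ := fun t => (u t).re with hv
  have hvmem : MemLp v 2 volume := by
    refine ⟨Complex.continuous_re.comp_aestronglyMeasurable hu2.1, ?_⟩
    refine lt_of_le_of_lt (eLpNorm_mono fun t => ?_) hu2.2
    simpa [hv, Real.norm_eq_abs] using Complex.abs_re_le_norm (u t)
  have hHmem : MemLp H 2 volume := memLp_weilOddThetaVector a 2
  have hiH : Integrable (fun t => v t * H t) := hvmem.integrable_mul hHmem
  have hiT : Integrable (fun t => v t * T t) := hvmem.integrable_mul hTmem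
  have hre : ∀ (F : ℝ → ℝ), MemLp F 2 volume →
      (∫ t, u t * ((F t : ℝ) : ℂ)).re = ∫ t, v t * F t := by
    intro F hF
    have hi : Integrable (fun t => u t * ((F t : ℝ) : ℂ)) := hu2.integrable_mul hF.ofReal
    have key := integral_re hi
    simp only [RCLike.re_to_complex] at key
    rw [← key]
    refine integral_congr_ae (Eventually.of_forall fun t => ?_)
    simp [hv, Complex.mul_re]
  have hlimR : ε * ∫ t, v t * H t = ∫ t, v t * T t := by
    have h3 := congrArg Complex.re hlimC
    rw [Complex.re_ofReal_mul, hre H hHmem, hre T hTmem] at h3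
    exact h3
  -- (4) sign information, reflected to `(−a, 0)`
  have hodd : ∀ᵐ t : ℝ, u (-t) = -u t := hu.ae_neg
  have hsign' : ∀ᵐ t : ℝ, -t ∈ Ioo 0 a → (u (-t)).im = 0 ∧ 0 ≤ (u (-t)).re := ae_comp_neg hsign
  have hzero : ∀ᵐ t : ℝ, t ∉ Icc (-a) a → u t = 0 := hu.ae_eq_zero_of_notMem
  -- the floor in the form `0 ≤ T t + e H t` on `(0,a)` and `≤ 0` on `(−a,0)`
  have hpos : ∀ t ∈ Ioo 0 a, 0 ≤ T t + e * H t := fun t ht => by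
    have htm : t ∈ Ioo (-a) a := ⟨by linarith [ht.1], ht.2⟩
    have := hfl t ht
    simp only [hT, indicator_of_mem htm, hH]
    linarith
  have hneg : ∀ t ∈ Ioo (-a) 0, T t + e * H t ≤ 0 := fun t ht => by
    have htm : t ∈ Ioo (-a) a := ⟨ht.1, by linarith [ht.2]⟩
    have hmt : -t ∈ Ioo 0 a := ⟨by linarith [ht.2], by linarith [ht.1]⟩
    have h4 := hpos (-t) hmt
    have hmtm : -t ∈ Ioo (-a) a := ⟨by linarith [hmt.1, ha], hmt.2⟩
    simp only [hT, indicator_of_mem htm, indicator_of_mem hmtm, hH, oddThetaImage_neg,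
      weilOddThetaVector_neg] at h4 ⊢
    linarith
  -- (5) the integrand `v (T + eH)` is a.e. non-negative, and `v H` too
  have hnull3 : (volume : Measure ℝ) {-a, 0, a} = 0 := (Set.toFinite _).measure_zero volume
  have hae3 := measure_eq_zero_iff_ae_notMem.1 hnull3
  have hvH_nonneg : ∀ᵐ t : ℝ, 0 ≤ v t * H t := by
    filter_upwards [hsign, hsign', hodd, hae3] with t h1 h2 h3 h4
    simp only [mem_insert_iff, mem_singleton_iff, not_or] at h4
    rcases lt_trichotomy t 0 with hlt | heq | hgt
    · by_cases hta : -a < t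
      · have hmt : -t ∈ Ioo 0 a := ⟨by linarith, by linarith⟩
        have hre2 : v t = -(u (-t)).re := by simp [hv, h3]
        have : 0 ≤ (u (-t)).re := (h2 hmt).2
        have hHt : H t ≤ 0 := weilOddThetaVector_nonpos a hlt.le
        nlinarith
      · have hHt : H t = 0 := weilOddThetaVector_of_not_mem fun hm => by
          rcases eq_or_lt_of_le (not_lt.1 hta) with h5 | h5
          · exact h4.1 h5
          · exact absurd hm.1 (not_le.2 h5)
        simp [hHt]
    · exact absurd heq h4.2.1
    · by_cases hta : t < a
      · have : 0 ≤ v t := (h1 ⟨hgt, hta⟩).2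
        exact mul_nonneg this (weilOddThetaVector_nonneg a hgt.le)
      · have hHt : H t = 0 := weilOddThetaVector_of_not_mem fun hm => by
          rcases eq_or_lt_of_le (not_lt.1 hta) with h5 | h5
          · exact h4.2.2 h5.symm
          · exact absurd hm.2 (not_le.2 h5)
        simp [hHt]
  have hp_nonneg : ∀ᵐ t : ℝ, 0 ≤ v t * (T t + e * H t) := by
    filter_upwards [hsign, hsign', hodd, hae3] with t h1 h2 h3 h4
    simp only [mem_insert_iff, mem_singleton_iff, not_or] at h4
    rcases lt_trichotomy t 0 with hlt | heq | hgt
    · by_cases hta : -a < t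
      · have hmt : -t ∈ Ioo 0 a := ⟨by linarith, by linarith⟩
        have hre2 : v t = -(u (-t)).re := by simp [hv, h3]
        have : 0 ≤ (u (-t)).re := (h2 hmt).2
        have h6 := hneg t ⟨hta, hlt⟩
        nlinarith
      · have htI : t ∉ Ioo (-a) a := fun hm => hta hm.1
        have hHt : H t = 0 := weilOddThetaVector_of_not_mem fun hm => by
          rcases eq_or_lt_of_le (not_lt.1 hta) with h5 | h5
          · exact h4.1 h5
          · exact absurd hm.1 (not_le.2 h5)
        simp [hT, indicator_of_notMem htI, hHt]
    · exact absurd heq h4.2.1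
    · by_cases hta : t < a
      · exact mul_nonneg (h1 ⟨hgt, hta⟩).2 (hpos t ⟨hgt, hta⟩)
      · have htI : t ∉ Ioo (-a) a := fun hm => hta hm.2
        have hHt : H t = 0 := weilOddThetaVector_of_not_mem fun hm => by
          rcases eq_or_lt_of_le (not_lt.1 hta) with h5 | h5
          · exact h4.2.2 h5.symm
          · exact absurd hm.2 (not_le.2 h5)
        simp [hT, indicator_of_notMem htI, hHt]
  -- (6) `∫ v H > 0`
  have hI_pos : 0 < ∫ t, v t * H t := by
    rcases (integral_nonneg_of_ae hvH_nonneg).eq_or_lt with hz | hz'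
    · exfalso
      have hvH0 : (fun t => v t * H t) =ᵐ[volume] 0 :=
        (integral_eq_zero_iff_of_nonneg_ae hvH_nonneg hiH).1 hz.symm
      -- then `u = 0` a.e.
      have hu0 : ∀ᵐ t : ℝ, u t = 0 := by
        filter_upwards [hvH0, ae_comp_neg hvH0, hsign, hsign', hodd, hzero, hae3]
          with t h0 h0' h1 h2 h3 h5 h4
        simp only [mem_insert_iff, mem_singleton_iff, not_or] at h4
        simp only [Pi.zero_apply, mul_eq_zero] at h0 h0'
        by_cases hwin : t ∈ Icc (-a) a
        · rcases lt_trichotomy t 0 with hlt | heq | hgt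
          · have hmt : -t ∈ Ioo 0 a := ⟨by linarith, by
              rcases eq_or_lt_of_le hwin.1 with h6 | h6
              · exact absurd h6.symm h4.1
              · linarith⟩
            have hH0 : H (-t) ≠ 0 := (weilOddThetaVector_pos hmt.1 hmt.2.le).ne'
            have hvm : v (-t) = 0 := by
              rcases h0' with h7 | h7
              · exact h7
              · exact absurd h7 hH0
            have him := (h2 hmt).1
            have hure : (u (-t)).re = 0 := hvm
            have humt : u (-t) = 0 := Complex.ext hure him
            have := h3
            rw [humt] at this
            exact neg_eq_zero.1 this.symm
          · exact absurd heq h4.2.1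
          · have ht' : t ∈ Ioo 0 a := ⟨hgt, by
              rcases eq_or_lt_of_le hwin.2 with h6 | h6
              · exact absurd h6 h4.2.2
              · exact h6⟩
            have hH0 : H t ≠ 0 := (weilOddThetaVector_pos ht'.1 ht'.2.le).ne'
            have hvm : v t = 0 := by
              rcases h0 with h7 | h7
              · exact h7
              · exact absurd h7 hH0
            exact Complex.ext hvm (h1 ht').1
        · exact h5 hwin
      have hnorm := hu.integral_norm_sq
      have : ∫ t, ‖u t‖ ^ 2 = 0 := by
        rw [← integral_zero (α := ℝ)]  -- placeholder
        exact integral_congr_ae (hu0.mono fun t ht => by simp [ht])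
      linarith
    · exact hz'
  -- (7) integrate the non-negative integrand: `0 ≤ ∫ v T + e ∫ v H = (ε + e) ∫ v H`
  have hint : 0 ≤ (ε + e) * ∫ t, v t * H t := by
    have h7 : 0 ≤ ∫ t, v t * (T t + e * H t) := integral_nonneg_of_ae hp_nonneg
    have h8 : ∫ t, v t * (T t + e * H t) = (∫ t, v t * T t) + e * ∫ t, v t * H t := by
      rw [← integral_const_mul, ← integral_add hiT (hiH.const_mul e)]
      refine integral_congr_ae (Eventually.of_forall fun t => ?_)
      simp only
      ring
    rw [h8, ← hlimR] at h7
    linarith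
  have h9 : 0 ≤ ε + e := (mul_nonneg_iff_of_pos_right hI_pos).1 hint
  linarith

/-! ## The crux -/

/-- **The odd Barta floor** (crux `OddSector.OddBartaFloor`, stmt-RiemannHypothesis-17779): with `e`
and `a₀` from the supersolution inequality (`stub_asmFloor`), at every window `a ≥ max a₀ 1` carrying a
one-signed odd bottom state every normalised odd window test has `Re Q ≥ ε_od(a) ≥ −e(a)`. -/
theorem OddBartaFloor_of : Summit.RiemannHypothesis.RiemannHypothesis.Theses.OddSector.OddBartaFloor := by
  rw [show Summit.RiemannHypothesis.RiemannHypothesis.Theses.OddSector.OddBartaFloor ↔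
      (∃ e : ℝ → ℝ, Tendsto e atTop (nhds 0) ∧ ∃ a₀ : ℝ, ∀ a : ℝ, a₀ ≤ a →
        (∃ u : ℝ → ℂ, IsWeilOddGroundState a u ∧ (∀ᵐ t : ℝ, t ∈ Ioo 0 a → (u t).im = 0 ∧ 0 ≤ (u t).re)) →
        ∀ h : ℝ → ℂ, IsWeilTest h → tsupport h ⊆ Icc (-a) a → (∀ t, h (-t) = -h t) →
          ∫ t, ‖h t‖ ^ 2 = (1 : ℝ) → -e a ≤ (weilQuadratic h).re) from Iff.rfl]
  obtain ⟨a₀, e, he, hfl⟩ := stub_asmFloor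
  refine ⟨e, he, max a₀ 1, fun a ha hgood h hh hs hodd hnorm => ?_⟩
  obtain ⟨u, hu, hsign⟩ := hgood
  have ha₀ : a₀ ≤ a := le_trans (le_max_left _ _) ha
  have ha1 : 0 < a := lt_of_lt_of_le one_pos (le_trans (le_max_right _ _) ha)
  have hfloor := neg_le_weilOddGroundEnergy_of_floor ha1 (hfl a ha₀) hu hsign
  exact hfloor.trans (weilOddGroundEnergy_le hh hs hodd hnorm)

end Summit.RiemannHypothesis.RiemannHypothesis.Theorems.OddBartaFloor

end
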